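import Summits.SmoothPoincare4.SmoothPoincare4.Theorems.CylinderEntropyCylinderRungTwoKillingFluxDefs
import Summits.SmoothPoincare4.SmoothPoincare4.Theorems.CylinderEntropyCylinderRungTwoHamiltonMonotonicity
import Summits.SmoothPoincare4.SmoothPoincare4.Theorems.CylinderEntropySliceCalibration
import Literature.Geometry.Riemannian.SphericalCylinderInclusionDomination
import Literature.Geometry.Riemannian.ColdingMinicozziEntropy
import HarnessLib

/-!
# Route `CylinderEntropy`, crux `CylinderRungTwo` (stmt-SmoothPoincare4-7631), line `killing-flux`:
# ε-regularity of thin cylinder flows FROM White's local regularity theorem in single-sheet form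
# (registered helper `helper_epsilonRegularityOfWhite`)

The registered stub `stub_epsilonRegularity` of the line asks: there are universal `ε, C, c, r₀ > 0`
such that for every smooth mean curvature flow `(F, ν)` of closed embedded cross-sections of
`N = S⁴ × ℝ ⊂ ℝ⁶` (`IsCylinderMCF`, `…KillingFluxDefs.lean`) that is `(1+ε)`-THIN on a unit time
window, `λ_cyl(M_s) < 1 + ε` for `s ∈ [t-1, t]` (`λ_cyl = cylEntropy`, the typed cylinder entropy),
the final slice `M_t` has (a) a vertical Gauss map `ν₅` that is `C`-Lipschitz for the chordal
distance at scale `r₀` and (b) the lower area bound `c r⁴ ≤ μH⁴(M_t ∩ B(F t x, r))`, `r ≤ r₀`.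
The lead reshaped it as `helper_epsilonRegularityOfWhite stub_whiteRegularitySheet`, where

* `stub_whiteRegularitySheet` (the HYPOTHESIS of the helper proved here; B. White, *A local
  regularity theorem for mean curvature flow*, Ann. of Math. 161 (2005), Thm. 3.1 with §4, in
  single-sheet form for cylinder flows) says: there are universal `ε, C, c, c₁, d₀ > 0` such that
  for a cylinder flow, a time `t` and a scale `0 < d ≤ d₀` with `T + d² ≤ t`, if the EUCLIDEAN
  Gaussian density ratios `Θ((y, s), r) = gaussianArea 4 y (r²) (M_{s-r²})` in `ℝ⁶` are `≤ 1 + ε`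
  for all centres `y ∈ ℝ⁶`, all `s ≤ t + d²` and radii `r > 0` with `t - d² ≤ s - r²`, then at
  time `t` (a') `‖ν t x - ν t y‖ ≤ (C/d) ‖F t x - F t y‖` whenever `‖F t x - F t y‖ ≤ c₁ d` and
  (b') `c r⁴ ≤ μH⁴(M_t ∩ B(F t x, r))` for `0 < r ≤ c₁ d`;
* `helper_epsilonRegularityOfWhite : <that statement> → <stub_epsilonRegularity>` is the
  sorry-free glue proved in this file (`epsilonRegularity_of_whiteSheet`, parametrised by the
  sheet statement and by the small-scale domination, then specialised).

THE PROOF.  Constants: `ε = min(ε_W, 1)/3` (so `(1+ε)² ≤ 1 + ε_W`), window scale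
`d = min(d₀, r₁(ε)/2, 1)`, `C = C_W/d`, `c = c_W`, `r₀ = c₁ d`.  Given a `(1+ε)`-thin window
`[t-1, t]`: thinness at time `t - 1` propagates to EVERY later slice by Hamilton's monotonicity
(`IsCylinderMCF.cylEntropy_range_le_of_le`, from the landed `IsCylinderMCF.cylDensity_le`), so the
two-sided window `[t-d², t+d²]` of White's theorem is available; every slice `M_{s-r²}` entering a
density ratio of that window has `s - r² ≥ t - 1 ≥ T` and radius `r ≤ √2 d ≤ r₁`, so the PROVED
small-scale Gaussian domination for the inclusion `N ⊂ ℝ⁶`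
(`Literature…SphericalCylinderInclusion.gaussianArea_le_mul_cylEntropy_of_small_scale`:
`gaussianArea 4 y (r²) A ≤ (1+ε) λ_cyl(A)` for measurable `A ⊆ N`, `r ≤ r₁(ε)`) bounds the
Euclidean ratio by `(1+ε) λ_cyl ≤ (1+ε)² ≤ 1 + ε_W`; White's (a') gives (a) through `|v₅| ≤ ‖v‖`,
and (b') is (b).

Also proved: `densityHypothesis_staticSlice`, NON-VACUITY of the density hypothesis as typed — the
static slice flow (tree `isCylinderMCF_staticSlice`) satisfies it at small scales for every `ε > 0`
(domination + the landed calibration `λ_cyl(S⁴ × {0}) ≤ 1`, `cylEntropy_slice₀_le_one`), so the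
Euclidean normalisation `Θ(4-disc) → 1` is the right one.

Everything here is PROVED (no `sorry`, no definitions, no named facts); White's theorem itself is
NOT asserted — it is the hypothesis.

References: B. White, Ann. of Math. 161 (2005) 1487–1519, Thm. 3.1, §4; R. S. Hamilton, Comm.
Anal. Geom. 1 (1993) 127–137 (monotonicity on `S⁴ × ℝ`); T. H. Colding, W. P. Minicozzi II, Ann.
of Math. 175 (2012) 755–833 (Gaussian areas).
-/

-- the prescribed namespace `Summit.SmoothPoincare4.SmoothPoincare4.…` repeats `SmoothPoincare4`
set_option linter.dupNamespace false

noncomputable section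

open MeasureTheory Set Metric
open scoped Manifold ContDiff ENNReal NNReal Topology BigOperators

namespace Summit.SmoothPoincare4.SmoothPoincare4.Cruxes.CylinderRungTwo.KillingFlux

open Literature.Geometry.Riemannian
open Literature.Geometry.Riemannian.SphericalCylinderEntropy (cylEntropy cylDensity)
open Literature.Geometry.Riemannian.SphericalCylinderInclusion
  (gaussianArea_le_mul_cylEntropy_of_small_scale)

/-! ## Glue: slices of a cylinder flow -/

section Glue

variable {M : Type} [TopologicalSpace M] [ChartedSpace (EuclideanSpace ℝ (Fin 4)) M]
  [IsManifold (𝓡 4) ∞ M] [T2Space M] [CompactSpace M] {F ν : ℝ → M → EuclideanSpace ℝ (Fin 6)}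
  {T : ℝ}

omit [T2Space M] [CompactSpace M] in
/-- Time slices of a cylinder flow lie in `N = {∑_{i<5} zᵢ² = 1}`. [folklore] -/
theorem IsCylinderMCF.sum_sq_of_mem_range (hF : IsCylinderMCF M F ν T) {s : ℝ} (hs : T ≤ s) :
    ∀ z ∈ Set.range (F s), ∑ i : Fin 5, z (Fin.castSucc i) ^ 2 = 1 := by
  rintro _ ⟨x, rfl⟩
  exact hF.mem_cyl s hs x

omit [T2Space M] in
/-- Time slices of a cylinder flow are measurable (compact) subsets of `ℝ⁶`. [folklore] -/
theorem IsCylinderMCF.measurableSet_range (hF : IsCylinderMCF M F ν T) {s : ℝ} (hs : T ≤ s) :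
    MeasurableSet (Set.range (F s)) :=
  (isCompact_range (hF.isSmoothEmbedding s hs).contMDiff.continuous).isClosed.measurableSet

/-- **The typed cylinder entropy is non-increasing along a cylinder flow**, `λ_cyl(M_{s'}) ≤ λ_cyl(M_s)`
for `T ≤ s ≤ s'` (from the landed Hamilton monotonicity `IsCylinderMCF.cylDensity_le`:
`F̂_{p,τ}(M_{s'}) ≤ F̂_{p,τ+s'-s}(M_s) ≤ λ_cyl(M_s)`). [cite: Hamilton1993, Thm. 4.1] -/
theorem IsCylinderMCF.cylEntropy_range_le_of_le (hF : IsCylinderMCF M F ν T) {s s' : ℝ} (hs : T ≤ s)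
    (hss' : s ≤ s') : cylEntropy (Set.range (F s')) ≤ cylEntropy (Set.range (F s)) := by
  simp only [SphericalCylinderEntropy.cylEntropy]
  refine iSup₂_le fun p hp => iSup₂_le fun τ hτ => ?_
  have h := hF.cylDensity_le hp hs (sub_nonneg.2 hss') hτ
  rw [add_sub_cancel] at h
  exact le_iSup₂_of_le p hp (le_iSup₂_of_le (τ + (s' - s)) (by linarith) h)

end Glue

/-- A coordinate of a vector of `ℝ⁶` is bounded by its Euclidean norm. [folklore] -/
theorem abs_apply_le_norm_E6 (v : EuclideanSpace ℝ (Fin 6)) (i : Fin 6) : |v i| ≤ ‖v‖ := by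
  rw [EuclideanSpace.norm_eq]
  have hi : ‖v i‖ ^ 2 ≤ ∑ j, ‖v j‖ ^ 2 :=
    Finset.single_le_sum (fun j _ => sq_nonneg ‖v j‖) (Finset.mem_univ i)
  calc |v i| = √(‖v i‖ ^ 2) := by rw [Real.sqrt_sq (norm_nonneg _), Real.norm_eq_abs]
    _ ≤ √(∑ j, ‖v j‖ ^ 2) := Real.sqrt_le_sqrt hi

/-! ## The derivation: White's sheet form + small-scale domination ⟹ the stub -/

/-- **ε-regularity of thin cylinder flows from White's theorem (single-sheet form) and a small-scale
Gaussian domination.**  Hypotheses: `hS`, White's local regularity theorem for cylinder flows in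
single-sheet form (universal `ε_W, C, c, c₁, d₀`; Euclidean Gaussian density ratios `≤ 1 + ε_W` on
the two-sided window of scale `d ≤ d₀` give (a') chordal `(C/d)`-Lipschitz normal at scale `c₁ d` and
(b') `c r⁴ ≤ μH⁴(M_t ∩ B(F t x, r))` for `r ≤ c₁ d`), and `hdom`, small-scale Gaussian domination on
`N` (`gaussianArea 4 y (r²) A ≤ (1+δ) λ_cyl(A)` for measurable `A ⊆ N`, `r ≤ r₁(δ)`).  Conclusion: the
registered `stub_epsilonRegularity`.  Constants `ε = min(ε_W, 1)/3`, `d = min(d₀, r₁(ε)/2, 1)`,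
`C/d`, `c`, `r₀ = c₁ d`; thinness at `t - 1` propagates forward (`cylEntropy_range_le_of_le`), every
slice `M_{s-r²}` of a ratio of the window has `s - r² ≥ t - 1` and `r ≤ √2 d ≤ r₁`, so
`Θ ≤ (1+ε) λ_cyl ≤ (1+ε)² ≤ 1 + ε_W`; then (a') ⟹ (a) by `|v₅| ≤ ‖v‖` and (b') = (b).
[cite: White2005, Thm. 3.1 and §4] -/
theorem epsilonRegularity_of_whiteSheet
    (hS : ∃ ε : ℝ, 0 < ε ∧ ∃ C : ℝ, 0 < C ∧ ∃ c : ℝ, 0 < c ∧ ∃ c₁ : ℝ, 0 < c₁ ∧ ∃ d₀ : ℝ, 0 < d₀ ∧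
      ∀ (M : Type) [TopologicalSpace M] [T2Space M] [SecondCountableTopology M]
        [ChartedSpace (EuclideanSpace ℝ (Fin 4)) M] [IsManifold (𝓡 4) ∞ M] [CompactSpace M]
        [ConnectedSpace M]
        (F : ℝ → M → EuclideanSpace ℝ (Fin 6)) (ν : ℝ → M → EuclideanSpace ℝ (Fin 6)) (T : ℝ),
        IsCylinderMCF M F ν T → ∀ t d : ℝ, 0 < d → d ≤ d₀ → T + d ^ 2 ≤ t →
        (∀ (y : EuclideanSpace ℝ (Fin 6)) (s r : ℝ), 0 < r → t - d ^ 2 ≤ s - r ^ 2 → s ≤ t + d ^ 2 →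
          gaussianArea 4 y (r ^ 2) (Set.range (F (s - r ^ 2))) ≤ ENNReal.ofReal (1 + ε)) →
        (∀ x y : M, ‖F t x - F t y‖ ≤ c₁ * d → ‖ν t x - ν t y‖ ≤ C / d * ‖F t x - F t y‖) ∧
        (∀ x : M, ∀ r : ℝ, 0 < r → r ≤ c₁ * d →
          ENNReal.ofReal (c * r ^ 4) ≤ μH[4] (Set.range (F t) ∩ Metric.ball (F t x) r)))
    (hdom : ∀ δ : ℝ, 0 < δ → ∃ r₁ : ℝ, 0 < r₁ ∧
      ∀ A : Set (EuclideanSpace ℝ (Fin 6)), (∀ z ∈ A, ∑ i : Fin 5, z (Fin.castSucc i) ^ 2 = 1) →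
        MeasurableSet A → ∀ (y : EuclideanSpace ℝ (Fin 6)) (r : ℝ), 0 < r → r ≤ r₁ →
          gaussianArea 4 y (r ^ 2) A ≤ ENNReal.ofReal (1 + δ) * cylEntropy A) :
    ∃ ε : ℝ, 0 < ε ∧ ∃ C : ℝ, 0 < C ∧ ∃ c : ℝ, 0 < c ∧ ∃ r₀ : ℝ, 0 < r₀ ∧
      ∀ (M : Type) [TopologicalSpace M] [T2Space M] [SecondCountableTopology M]
        [ChartedSpace (EuclideanSpace ℝ (Fin 4)) M] [IsManifold (𝓡 4) ∞ M] [CompactSpace M]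
        [ConnectedSpace M]
        (F : ℝ → M → EuclideanSpace ℝ (Fin 6)) (ν : ℝ → M → EuclideanSpace ℝ (Fin 6)) (T : ℝ),
        IsCylinderMCF M F ν T →
        ∀ t : ℝ, T + 1 ≤ t →
          (∀ s ∈ Set.Icc (t - 1) t, SeparatesEnds (Set.range (F s))) →
          (∀ s ∈ Set.Icc (t - 1) t, cylEntropy (Set.range (F s)) < ENNReal.ofReal (1 + ε)) →
          (∀ x y : M, ‖F t x - F t y‖ ≤ r₀ → |ν t x 5 - ν t y 5| ≤ C * ‖F t x - F t y‖) ∧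
          (∀ x : M, ∀ r : ℝ, 0 < r → r ≤ r₀ →
            ENNReal.ofReal (c * r ^ 4) ≤
              μH[4] (Set.range (F t) ∩ Metric.ball (F t x) r)) := by
  obtain ⟨εW, hεW, C, hC, c, hc, c₁, hc₁, d₀, hd₀, hW⟩ := hS
  -- the thinness margin `ε`
  set ε : ℝ := min εW 1 / 3 with hε_def
  have hε0 : 0 < ε := by positivity
  have hε1 : ε ≤ 1 / 3 := by
    have : min εW 1 ≤ 1 := min_le_right _ _
    rw [hε_def]; linarith
  have hεW' : 3 * ε ≤ εW := by
    have : min εW 1 ≤ εW := min_le_left _ _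
    rw [hε_def]; linarith
  have hprod : (1 + ε) * (1 + ε) ≤ 1 + εW := by nlinarith
  -- the comparison scale `r₁` and White's scale `d`
  obtain ⟨r₁, hr₁, hdom'⟩ := hdom ε hε0
  set d : ℝ := min d₀ (min (r₁ / 2) 1) with hd_def
  have hd0 : 0 < d := by positivity
  have hdd₀ : d ≤ d₀ := min_le_left _ _
  have hdr₁ : d ≤ r₁ / 2 := (min_le_right _ _).trans (min_le_left _ _)
  have hd1 : d ≤ 1 := (min_le_right _ _).trans (min_le_right _ _)
  have hd2 : d ^ 2 ≤ 1 := by nlinarith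
  refine ⟨ε, hε0, C / d, by positivity, c, hc, c₁ * d, by positivity, ?_⟩
  intro M _ _ _ _ _ _ _ F ν T hF t ht _hsep hthin
  have hT1 : T ≤ t - 1 := by linarith
  have htd : T + d ^ 2 ≤ t := by linarith
  -- thinness at time `t - 1`, propagated forward by Hamilton monotonicity
  have hthin1 : cylEntropy (Set.range (F (t - 1))) < ENNReal.ofReal (1 + ε) :=
    hthin (t - 1) ⟨le_rfl, by linarith⟩
  -- the Euclidean density hypothesis of White's theorem on the two-sided window of scale `d`
  have hdens : ∀ (y : EuclideanSpace ℝ (Fin 6)) (s r : ℝ), 0 < r → t - d ^ 2 ≤ s - r ^ 2 →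
      s ≤ t + d ^ 2 →
      gaussianArea 4 y (r ^ 2) (Set.range (F (s - r ^ 2))) ≤ ENNReal.ofReal (1 + εW) := by
    intro y s r hr h1 h2
    have hslice : t - 1 ≤ s - r ^ 2 := by linarith
    have hTs : T ≤ s - r ^ 2 := by linarith
    have hr2 : r ^ 2 ≤ r₁ ^ 2 := by nlinarith
    have hrr₁ : r ≤ r₁ := (pow_le_pow_iff_left₀ hr.le hr₁.le two_ne_zero).1 hr2
    have hthin' : cylEntropy (Set.range (F (s - r ^ 2))) ≤ ENNReal.ofReal (1 + ε) :=
      (hF.cylEntropy_range_le_of_le hT1 hslice).trans hthin1.le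
    calc gaussianArea 4 y (r ^ 2) (Set.range (F (s - r ^ 2)))
        ≤ ENNReal.ofReal (1 + ε) * cylEntropy (Set.range (F (s - r ^ 2))) :=
          hdom' _ (hF.sum_sq_of_mem_range hTs) (hF.measurableSet_range hTs) y r hr hrr₁
      _ ≤ ENNReal.ofReal (1 + ε) * ENNReal.ofReal (1 + ε) := by gcongr
      _ = ENNReal.ofReal ((1 + ε) * (1 + ε)) := (ENNReal.ofReal_mul (by positivity)).symm
      _ ≤ ENNReal.ofReal (1 + εW) := ENNReal.ofReal_le_ofReal hprod
  obtain ⟨hA, hB⟩ := hW M F ν T hF t d hd0 hdd₀ htd hdens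
  refine ⟨fun x y hxy => ?_, fun x r hr hrr => hB x r hr hrr⟩
  calc |ν t x 5 - ν t y 5| = |(ν t x - ν t y) 5| := by rw [PiLp.sub_apply]
    _ ≤ ‖ν t x - ν t y‖ := abs_apply_le_norm_E6 _ _
    _ ≤ C / d * ‖F t x - F t y‖ := hA x y hxy

/-- **The registered helper `helper_epsilonRegularityOfWhite`** (line `killing-flux`, crux
`CylinderRungTwo`): White's local regularity theorem for cylinder flows in single-sheet form
(`stub_whiteRegularitySheet`, the hypothesis) implies the registered `stub_epsilonRegularity`, by
`epsilonRegularity_of_whiteSheet` and the PROVED small-scale Gaussian domination for the inclusion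
`N ⊂ ℝ⁶` (`SphericalCylinderInclusion.gaussianArea_le_mul_cylEntropy_of_small_scale`).
[cite: White2005, Thm. 3.1 and §4] -/
theorem helper_epsilonRegularityOfWhite :
    (∃ ε : ℝ, 0 < ε ∧ ∃ C : ℝ, 0 < C ∧ ∃ c : ℝ, 0 < c ∧ ∃ c₁ : ℝ, 0 < c₁ ∧ ∃ d₀ : ℝ, 0 < d₀ ∧ ∀ (M : Type) [TopologicalSpace M] [T2Space M] [SecondCountableTopology M] [ChartedSpace (EuclideanSpace ℝ (Fin 4)) M] [IsManifold (𝓡 4) ∞ M] [CompactSpace M] [ConnectedSpace M] (F : ℝ → M → EuclideanSpace ℝ (Fin 6)) (ν : ℝ → M → EuclideanSpace ℝ (Fin 6)) (T : ℝ), IsCylinderMCF M F ν T → ∀ t d : ℝ, 0 < d → d ≤ d₀ → T + d ^ 2 ≤ t → (∀ (y : EuclideanSpace ℝ (Fin 6)) (s r : ℝ), 0 < r → t - d ^ 2 ≤ s - r ^ 2 → s ≤ t + d ^ 2 → gaussianArea 4 y (r ^ 2) (Set.range (F (s - r ^ 2))) ≤ ENNReal.ofReal (1 + ε)) → (∀ x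 y : M, ‖F t x - F t y‖ ≤ c₁ * d → ‖ν t x - ν t y‖ ≤ C / d * ‖F t x - F t y‖) ∧ (∀ x : M, ∀ r : ℝ, 0 < r → r ≤ c₁ * d → ENNReal.ofReal (c * r ^ 4) ≤ μH[4] (Set.range (F t) ∩ Metric.ball (F t x) r))) → ∃ ε : ℝ, 0 < ε ∧ ∃ C : ℝ, 0 < C ∧ ∃ c : ℝ, 0 < c ∧ ∃ r₀ : ℝ, 0 < r₀ ∧ ∀ (M : Type) [TopologicalSpace M] [T2Space M] [SecondCountableTopology M] [ChartedSpace (EuclideanSpace ℝ (Fin 4)) M] [IsManifold (𝓡 4) ∞ M] [CompactSpace M] [ConnectedSpace M] (F : ℝ → M → EuclideanSpace ℝ (Fin 6)) (ν : ℝ → M → EuclideanSpace ℝ (Fin 6)) (T : ℝ), IsCylinderMCF M F ν T → ∀ t : ℝ, T + 1 ≤ t → (∀ s ∈ Set.Icc (t - 1) t, SeparatesEnds (Set.range (F s))) → (∀ s ∈ Set.Icc (t - 1) t, cylEntropy (Set.range (F s)) < ENNReal.ofReal (1 + ε)) → (∀ x y : M, ‖F t x - F t y‖ ≤ r₀ →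 |ν t x 5 - ν t y 5| ≤ C * ‖F t x - F t y‖) ∧ (∀ x : M, ∀ r : ℝ, 0 < r → r ≤ r₀ → ENNReal.ofReal (c * r ^ 4) ≤ μH[4] (Set.range (F t) ∩ Metric.ball (F t x) r)) :=
  fun hS => epsilonRegularity_of_whiteSheet hS gaussianArea_le_mul_cylEntropy_of_small_scale

/-! ## Non-vacuity of the density hypothesis of White's theorem as typed -/

section NonVacuity

open Literature.Geometry.Manifold.CylinderSlice (sliceMap range_sliceMap sum_sq_sliceMap)
open Literature.Geometry.Riemannian.SphericalCylinderEntropy (measurableSet_range_sliceMap)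
open Summit.SmoothPoincare4.SmoothPoincare4.Theorems (cylEntropy_slice₀_le_one)

/-- **The density hypothesis of White's theorem as typed is satisfiable** (so the sheet statement
is not vacuous through a normalisation slip): for every `ε > 0` there is a scale `d > 0` such that
the static slice flow `F s = sliceMap 0` (tree `isCylinderMCF_staticSlice`) has all the Euclidean
Gaussian density ratios of the two-sided window of scale `d` bounded by `1 + ε` — by the PROVED
domination and the landed calibration `λ_cyl(S⁴ × {0}) ≤ 1` (`cylEntropy_slice₀_le_one`).  In
particular a `4`-disc of `N` has Euclidean density ratio `→ 1`, White's normalisation. [folklore] -/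
theorem densityHypothesis_staticSlice (ε : ℝ) (hε : 0 < ε) :
    ∃ d : ℝ, 0 < d ∧ ∀ (t : ℝ) (y : EuclideanSpace ℝ (Fin 6)) (s r : ℝ), 0 < r →
      t - d ^ 2 ≤ s - r ^ 2 → s ≤ t + d ^ 2 →
        gaussianArea 4 y (r ^ 2) (Set.range ((fun _ : ℝ => sliceMap 0) (s - r ^ 2))) ≤
          ENNReal.ofReal (1 + ε) := by
  obtain ⟨r₁, hr₁, h⟩ := gaussianArea_le_mul_cylEntropy_of_small_scale ε hε
  refine ⟨r₁ / 2, by positivity, fun t y s r hr h1 h2 => ?_⟩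
  have hr2 : r ^ 2 ≤ r₁ ^ 2 := by nlinarith
  have hrr₁ : r ≤ r₁ := (pow_le_pow_iff_left₀ hr.le hr₁.le two_ne_zero).1 hr2
  have hcal : cylEntropy (Set.range (sliceMap 0)) ≤ 1 := by
    rw [range_sliceMap]; exact cylEntropy_slice₀_le_one
  have hsub : ∀ z ∈ Set.range (sliceMap 0), ∑ i : Fin 5, z (Fin.castSucc i) ^ 2 = 1 := by
    rintro _ ⟨x, rfl⟩; exact sum_sq_sliceMap 0 x
  calc gaussianArea 4 y (r ^ 2) (Set.range (sliceMap 0))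
      ≤ ENNReal.ofReal (1 + ε) * cylEntropy (Set.range (sliceMap 0)) :=
        h _ hsub (measurableSet_range_sliceMap 0) y r hr hrr₁
    _ ≤ ENNReal.ofReal (1 + ε) * 1 := by gcongr
    _ = ENNReal.ofReal (1 + ε) := mul_one _

end NonVacuity

end Summit.SmoothPoincare4.SmoothPoincare4.Cruxes.CylinderRungTwo.KillingFlux

end
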